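import Summits.Ventures.YMGap.Thresholds.SharpClusteringSmooth
import Summits.Ventures.YMGap.Thresholds.SharpClusteringLimitPrep
import Summits.Ventures.YMGap.Thresholds.StarLimitLipschitz
import Literature.MathematicalPhysics.QuantumFieldTheory.LatticeYangMillsClusteringTransfer
import HarnessLib

/-!
# Venture YMGap — track (a), R119 brick L, part 2: from a TORUS covariance decay bound for smooth
# per-link-Lipschitz functions, uniform in the side `L`, to Shen–Zhu–Zhu's EXPONENTIAL CLUSTERING
# OF EVERY TIGHT LIMIT (`SZZExponentialClustering d N β`)

HONEST FRAMING: venture file (cell `pub-ymgap`, track (a), seat ds-2, brick L for lit-1's R119 line =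
static discharge of `shenZhuZhu_massGap_transfer`). A TRANSFER theorem: its hypothesis (T) is the
torus covariance bound that lit-1's `SharpClusteringTorus.torus_covariance_exp_decay` outputs (signature
fixed on the cell bus 2026-08-22T15:08Z), its conclusion is the tree's `SZZExponentialClustering d N β`
(Shen–Zhu–Zhu CMP 400 (2023), Cor. 4.11, for every infinite-volume limit point). Nothing is assumed or
proved here about WHEN (T) holds; lattice strong coupling only; nothing about the continuum.

(T) at 't Hooft coupling `β` (tree coupling `Nβ`) with constants `A ≥ 0`, `κ > 0`: for every torus side
`L ≥ 2`, all smooth ambient functions `u, v` on `(E⁺(Λ_L) → M_N(ℂ))` that are `δu_e`- resp.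
`δv_e`-Lipschitz in the link `e` on `SU(N)^E` (p2's `LinkLipschitz`), and every `m` such that links
carrying nonzero Lipschitz data of `u` and of `v` have base points at periodic sup-distance `≥ m`,
`|cov_{μ_{L,Nβ}}(u, v)| ≤ A e^{-κ m} (Σ_e δu_e)(Σ_e δv_e)`.

CONCLUSION: for every `μ ∈ infiniteVolumeLimitPoints (fundamentalRep (Fin N)) (Nβ)`, every `n` and
all Lipschitz cylinder functions `F₁, F₂` (`IsLipschitzCylinder`, constants `K₁, K₂`, supports
`Λ₁, Λ₂` of size `≤ n`): `|cov_μ(F₁,F₂)| ≤ A n² e^{κ} · e^{-κ d(Λ₁,Λ₂)} (K₁K₂ + ‖F₁‖₂‖F₂‖₂)`, rate `κ`.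

Proof: (1) smooth the Lipschitz cylinder functions on the `ℤ^d` side keeping the Lipschitz constants
(`SharpClusteringSmooth`); (2) pull the smooth cylinder functions back to large tori of the defining
subsequence (`u(Q) = g((Q_{π_L e})_{e ∈ Λ})`; smooth; `LinkLipschitz` with data `K·#{e ∈ Λ : π_L e = ·}`,
total mass `K·|Λ|`; the projection is isometric on the supports below half the period); (3) apply (T)
with `m = ⌊d(Λ₁,Λ₂)⌋`; (4) pass to the weak limit (ds-2 gen-4 `StarLimit.abs_cov_le_of_eventually_torus`);
(5) let the smoothing parameter go to `0` (covariances move by `O(η)`).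

References: H. Shen, R. Zhu, X. Zhu, CMP 400 (2023) 805–851, Cor. 4.11 and its proof p. 28–30;
cell files `lit/A2-DEBT-MAP.md` (lit-1), `ds/ds2-g5/LIMIT-BRICK-OFFER.md`.
-/

noncomputable section

open MeasureTheory ProbabilityTheory Filter Topology Finset
open scoped NNReal ContDiff Matrix.Norms.Frobenius
open Literature.MathematicalPhysics.QuantumLattice (LGConfig ZdEdge torusEdge torusLift toTorusObservable
  toTorusObservable_apply IsCylinder fundamentalRep continuous_fundamentalRep infiniteVolumeLimitPoints
  IsInfiniteVolumeLimitAlong)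
open Literature.MathematicalPhysics.QuantumFieldTheory hiding ZdEdge
open Summit.Ventures.YMGap.LatticeBakryEmery (Cfg PSU emb emb_apply LinkLipschitz)
open Summit.Ventures.YMGap.StarLimit (abs_cov_le_of_eventually_torus continuous_of_isLipschitzCylinder)

namespace Summit.Ventures.YMGap

namespace SharpClustering

/-! ### The transfer theorem -/

section Transfer

variable {d N : ℕ}

/-- **Brick L: a torus covariance decay bound for smooth per-link-Lipschitz functions, uniform in the
side, gives Shen–Zhu–Zhu's exponential clustering of every tight limit.** Hypothesis (T) is the exact
output shape of `SharpClusteringTorus.torus_covariance_exp_decay` (lit-1, R119 Part IV) with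
constants `A ≥ 0` and rate `κ > 0`; conclusion `SZZExponentialClustering d N β` with rate `κ` and
`c₁ = A n² e^{κ}`. -/
theorem szzExponentialClustering_of_torusDecay (β : ℝ) {A κ : ℝ} (hA : 0 ≤ A) (hκ : 0 < κ)
    (hT : ∀ (L : ℕ) [NeZero L], 1 < L → ∀ (u v : Cfg (Edge d L) N → ℝ), ContDiff ℝ ∞ u → ContDiff ℝ ∞ v →
      ∀ (δu δv : Edge d L → ℝ), (∀ e, 0 ≤ δu e) → (∀ e, 0 ≤ δv e) →
        LinkLipschitz u δu → LinkLipschitz v δv → ∀ (m : ℕ),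
          (∀ e e', δu e ≠ 0 → δv e' ≠ 0 → m ≤ torusNorm (e.1 - e'.1)) →
            |cov[fun U => u (emb U), fun U => v (emb U);
                wilsonMeasure (d := d) (L := L) (fundamentalRep (Fin N)) ((N : ℝ) * β)]| ≤
              A * Real.exp (-κ * m) * (∑ e, δu e) * (∑ e, δv e)) :
    SZZExponentialClustering d N β := by
  classical
  intro μ hμ
  refine ⟨κ, hκ, fun n => ⟨A * (n : ℝ) ^ 2 * Real.exp κ, ?_⟩⟩
  intro F₁ F₂ Λ₁ Λ₂ K₁ K₂ h₁ h₂ _ hF₁ hF₂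
  haveI : SecondCountableTopology (Matrix (Fin N) (Fin N) ℂ) :=
    inferInstanceAs (SecondCountableTopology (Fin N → Fin N → ℂ))
  haveI : SecondCountableTopology (Matrix.specialUnitaryGroup (Fin N) ℂ) :=
    Topology.IsEmbedding.subtypeVal.secondCountableTopology
  obtain ⟨Ls, hLmono, hμL⟩ := hμ
  haveI := hμL.1
  have hK₁ : (0 : ℝ) ≤ K₁ := K₁.2
  have hK₂ : (0 : ℝ) ≤ K₂ := K₂.2
  -- bounds for the Lipschitz cylinder functions
  set M₁ : ℝ := |F₁ 1| + 2 * K₁ with hM₁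
  set M₂ : ℝ := |F₂ 1| + 2 * K₂ with hM₂
  have hFM₁ : ∀ U, |F₁ U| ≤ M₁ := fun U => hF₁.abs_le U
  have hFM₂ : ∀ U, |F₂ U| ≤ M₂ := fun U => hF₂.abs_le U
  have hM₁0 : 0 ≤ M₁ := (abs_nonneg _).trans (hFM₁ 1)
  have hM₂0 : 0 ≤ M₂ := (abs_nonneg _).trans (hFM₂ 1)
  -- distance scale
  set Dst : ℝ := setDistEdges Λ₁ Λ₂ with hDst
  have hDst0 : 0 ≤ Dst := setDistEdges_nonneg Λ₁ Λ₂
  set m : ℕ := ⌊Dst⌋₊ with hm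
  set Dmax : ℕ := ((Λ₁ ∪ Λ₂) ×ˢ (Λ₁ ∪ Λ₂)).sup fun ab =>
    Literature.Probability.LatticeModels.Site.supNorm (ab.1.1 - ab.2.1) with hDmax
  have hDm : ∀ a ∈ Λ₁ ∪ Λ₂, ∀ b ∈ Λ₁ ∪ Λ₂,
      Literature.Probability.LatticeModels.Site.supNorm (a.1 - b.1) ≤ Dmax := fun a ha b hb =>
    Finset.le_sup (f := fun ab : ZdEdge d ×
        ZdEdge d =>
      Literature.Probability.LatticeModels.Site.supNorm (ab.1.1 - ab.2.1)) (Finset.mk_mem_product ha hb)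
  -- the η-independent bound
  set b : ℝ := A * Real.exp (-κ * m) * ((K₁ : ℝ) * Λ₁.card) * ((K₂ : ℝ) * Λ₂.card) with hbdef
  -- Step A: for every smoothing scale `η ∈ (0,1]`, `|cov_μ(F₁,F₂)| ≤ b + η C₀`
  set C₀ : ℝ := 2 * ((K₁ : ℝ) * M₂ + (M₁ + K₁) * K₂) with hC₀
  have hC₀0 : 0 ≤ C₀ := by
    rw [hC₀]
    have := mul_nonneg hK₁ hM₂0
    have := mul_nonneg (add_nonneg hM₁0 hK₁) hK₂
    linarith
  have stepA : ∀ η : ℝ, 0 < η → η ≤ 1 → |cov[F₁, F₂; μ]| ≤ b + η * C₀ := by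
    intro η hη hη1
    obtain ⟨g₁, hg₁, hg₁K, hg₁F⟩ := exists_contDiff_lipschitz_cylinder_approx hF₁ hη
    obtain ⟨g₂, hg₂, hg₂K, hg₂F⟩ := exists_contDiff_lipschitz_cylinder_approx hF₂ hη
    -- the smooth cylinder functions on `ℤ^d`
    set G₁ : LGConfig d (Matrix.specialUnitaryGroup (Fin N) ℂ) → ℝ := fun U => g₁ fun e => suEntries (U e) with hG₁
    set G₂ : LGConfig d (Matrix.specialUnitaryGroup (Fin N) ℂ) → ℝ := fun U => g₂ fun e => suEntries (U e) with hG₂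
    have hG₁c : Continuous G₁ :=
      hg₁.continuous.comp (continuous_pi fun e => continuous_suEntries.comp (continuous_apply _))
    have hG₂c : Continuous G₂ :=
      hg₂.continuous.comp (continuous_pi fun e => continuous_suEntries.comp (continuous_apply _))
    have hG₁m : Measurable G₁ := hg₁.continuous.measurable.comp (measurable_suEntries_tuple Λ₁)
    have hG₂m : Measurable G₂ := hg₂.continuous.measurable.comp (measurable_suEntries_tuple Λ₂)
    have hG₁T : IsCylinder G₁ Λ₁ := by
      intro U V hUV
      simp only [hG₁]
      congr 1
      funext e
      rw [hUV e e.2]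
    have hG₂T : IsCylinder G₂ Λ₂ := by
      intro U V hUV
      simp only [hG₂]
      congr 1
      funext e
      rw [hUV e e.2]
    have hGF₁ : ∀ U, |F₁ U - G₁ U| ≤ K₁ * η := fun U => by rw [abs_sub_comm]; exact hg₁F U
    have hGF₂ : ∀ U, |F₂ U - G₂ U| ≤ K₂ * η := fun U => by rw [abs_sub_comm]; exact hg₂F U
    have hGM₁ : ∀ U, |G₁ U| ≤ M₁ + K₁ := fun U => by
      have h1 := hg₁F U
      have h2 := hFM₁ U
      have h3 : (K₁ : ℝ) * η ≤ K₁ := by nlinarith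
      calc |G₁ U| = |(G₁ U - F₁ U) + F₁ U| := by ring_nf
        _ ≤ |G₁ U - F₁ U| + |F₁ U| := abs_add_le _ _
        _ ≤ K₁ * η + M₁ := add_le_add h1 h2
        _ ≤ M₁ + K₁ := by linarith
    have hGM₂ : ∀ U, |G₂ U| ≤ M₂ + K₂ := fun U => by
      have h1 := hg₂F U
      have h2 := hFM₂ U
      have h3 : (K₂ : ℝ) * η ≤ K₂ := by nlinarith
      calc |G₂ U| = |(G₂ U - F₂ U) + F₂ U| := by ring_nf
        _ ≤ |G₂ U - F₂ U| + |F₂ U| := abs_add_le _ _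
        _ ≤ K₂ * η + M₂ := add_le_add h1 h2
        _ ≤ M₂ + K₂ := by linarith
    -- the weak-limit bound for the smooth pair
    have hcovG : |cov[G₁, G₂; μ]| ≤ b := by
      refine abs_cov_le_of_eventually_torus (fundamentalRep (Fin N)) hμL hG₁c hG₂c hG₁m hG₂m hG₁T hG₂T
        hGM₁ hGM₂ ?_
      filter_upwards [eventually_ge_atTop (max 1 (2 * Dmax))] with k hk
      have hkL : max 1 (2 * Dmax) ≤ Ls k := hk.trans hLmono.le_apply
      set L' : ℕ := Ls k + 1 with hL'
      have hL1 : 1 < L' := by omega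
      -- the torus pullbacks
      obtain ⟨hu, hLu⟩ := torusPullback_smooth_linkLipschitz (L := L') Λ₁ hg₁ hg₁K
      obtain ⟨hv, hLv⟩ := torusPullback_smooth_linkLipschitz (L := L') Λ₂ hg₂ hg₂K
      set u : Cfg (Edge d L') N → ℝ := fun Q => g₁ fun (e : ↥Λ₁) (i j : Fin N) =>
        Q (torusEdge L' (e : ZdEdge d)) i j with hudef
      set v : Cfg (Edge d L') N → ℝ := fun Q => g₂ fun (e : ↥Λ₂) (i j : Fin N) =>
        Q (torusEdge L' (e : ZdEdge d)) i j with hvdef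
      set δu : Edge d L' → ℝ := fun e' => (K₁ : ℝ) * ∑ e : ↥Λ₁,
        if torusEdge L' (e : ZdEdge d) = e' then (1 : ℝ) else 0 with hδu
      set δv : Edge d L' → ℝ := fun e' => (K₂ : ℝ) * ∑ e : ↥Λ₂,
        if torusEdge L' (e : ZdEdge d) = e' then (1 : ℝ) else 0 with hδv
      have hδu0 : ∀ e', 0 ≤ δu e' := fun e' =>
        mul_nonneg hK₁ (Finset.sum_nonneg fun e _ => by split_ifs <;> norm_num)
      have hδv0 : ∀ e', 0 ≤ δv e' := fun e' =>
        mul_nonneg hK₂ (Finset.sum_nonneg fun e _ => by split_ifs <;> norm_num)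
      -- separation of the supports on the torus
      have hiso : ∀ a ∈ Λ₁ ∪ Λ₂, ∀ b ∈ Λ₁ ∪ Λ₂,
          torusNorm ((torusEdge L' a).1 - (torusEdge L' b).1) =
            Literature.Probability.LatticeModels.Site.supNorm (a.1 - b.1) := by
        intro a ha b hb
        have hlt : 2 * Literature.Probability.LatticeModels.Site.supNorm (a.1 - b.1) < L' := by
          have := hDm a ha b hb; omega
        have e : (torusEdge L' a).1 - (torusEdge L' b).1 =
            Literature.Probability.LatticeModels.Torus.proj L' (a.1 - b.1) := by
          show Literature.Probability.LatticeModels.Torus.proj L' a.1 -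
              Literature.Probability.LatticeModels.Torus.proj L' b.1 = _
          rw [sub_eq_add_neg, ← torusProj_neg_zd, ← torusProj_add_zd, ← sub_eq_add_neg]
        rw [e]
        exact torusNorm_proj_eq hlt
      have hsep : ∀ e e' : Edge d L', δu e ≠ 0 → δv e' ≠ 0 → m ≤ torusNorm (e.1 - e'.1) := by
        intro e e' he he'
        obtain ⟨a, hane⟩ : ∃ a : ↥Λ₁,
            torusEdge L' (a : ZdEdge d) = e := by
          by_contra hcon
          push Not at hcon
          apply he
          simp only [hδu]
          rw [Finset.sum_eq_zero fun a _ => if_neg (hcon a), mul_zero]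
        obtain ⟨b', hbne⟩ : ∃ b' : ↥Λ₂,
            torusEdge L' (b' : ZdEdge d) = e' := by
          by_contra hcon
          push Not at hcon
          apply he'
          simp only [hδv]
          rw [Finset.sum_eq_zero fun a _ => if_neg (hcon a), mul_zero]
        rw [← hane, ← hbne, hiso a (Finset.mem_union_left _ a.2) b' (Finset.mem_union_right _ b'.2)]
        have hle := setDistEdges_le_supNorm_of_mem (Λ₁ := Λ₁) (Λ₂ := Λ₂) a.2 b'.2
        rw [hm]
        exact Nat.floor_le_of_le hle
      -- apply (T)
      have hTk := hT L' hL1 u v hu hv δu δv hδu0 hδv0 hLu hLv m hsep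
      rw [sum_torusData_eq, sum_torusData_eq] at hTk
      -- identify the torus covariance with the Wilson expectations of the pulled-back cylinders
      haveI := isProbabilityMeasure_wilsonMeasure (d := d) (L := L') (fundamentalRep (Fin N))
        (continuous_fundamentalRep (n := Fin N)) ((N : ℝ) * β)
      have huG : (fun U : PSU (Edge d L') N => u (emb U)) = toTorusObservable L' G₁ := by
        funext U; rfl
      have hvG : (fun U : PSU (Edge d L') N => v (emb U)) = toTorusObservable L' G₂ := by
        funext U; rfl
      have m₁ : MemLp (toTorusObservable L' G₁) 2
          (wilsonMeasure (d := d) (L := L') (fundamentalRep (Fin N)) ((N : ℝ) * β)) := by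
        rw [← huG]
        exact memLp_two_of_abs_le (LatticeBakryEmery.continuous_restrict hu).aestronglyMeasurable
          (C := M₁ + K₁) fun U => hGM₁ (torusLift L' U)
      have m₂ : MemLp (toTorusObservable L' G₂) 2
          (wilsonMeasure (d := d) (L := L') (fundamentalRep (Fin N)) ((N : ℝ) * β)) := by
        rw [← hvG]
        exact memLp_two_of_abs_le (LatticeBakryEmery.continuous_restrict hv).aestronglyMeasurable
          (C := M₂ + K₂) fun U => hGM₂ (torusLift L' U)
      have hcov := covariance_eq_sub m₁ m₂
      rw [huG, hvG, hcov] at hTk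
      exact hTk
    -- perturbation
    have hpert := abs_cov_sub_cov_le (μ := μ) hF₁.measurable.aestronglyMeasurable hG₁m.aestronglyMeasurable
      hF₂.measurable.aestronglyMeasurable hG₂m.aestronglyMeasurable hGM₁ hFM₂ hGF₁ hGF₂
    have e1 : 2 * ((K₁ : ℝ) * η * M₂ + (M₁ + K₁) * (K₂ * η)) = η * C₀ := by rw [hC₀]; ring
    rw [e1] at hpert
    have := abs_sub_abs_le_abs_sub (cov[F₁, F₂; μ]) (cov[G₁, G₂; μ])
    linarith
  -- Step B: let `η → 0`
  have hle : |cov[F₁, F₂; μ]| ≤ b := by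
    refine le_of_forall_pos_le_add fun ε hε => ?_
    set η : ℝ := min 1 (ε / (C₀ + 1)) with hη
    have hη0 : 0 < η := lt_min one_pos (div_pos hε (by linarith))
    have hη1 : η ≤ 1 := min_le_left _ _
    have hηε : η * C₀ ≤ ε := by
      have h1 : η ≤ ε / (C₀ + 1) := min_le_right _ _
      have h2 : ε / (C₀ + 1) * C₀ ≤ ε := by
        rw [div_mul_eq_mul_div, div_le_iff₀ (by linarith)]
        nlinarith
      nlinarith
    linarith [stepA η hη0 hη1]
  -- Step C: `b ≤ c₁ e^{-κ d} (K₁K₂ + …)`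
  refine hle.trans ?_
  have hmreal : Dst - 1 ≤ (m : ℝ) := by
    have := Nat.lt_floor_add_one Dst
    rw [← hm] at this
    linarith
  have hexp : Real.exp (-κ * m) ≤ Real.exp κ * Real.exp (-κ * Dst) := by
    rw [← Real.exp_add]
    exact Real.exp_le_exp.2 (by nlinarith)
  have hn₁ : (Λ₁.card : ℝ) ≤ n := by exact_mod_cast h₁
  have hn₂ : (Λ₂.card : ℝ) ≤ n := by exact_mod_cast h₂
  have hL2 : 0 ≤ Real.sqrt (∫ U, F₁ U ^ 2 ∂μ) * Real.sqrt (∫ U, F₂ U ^ 2 ∂μ) :=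
    mul_nonneg (Real.sqrt_nonneg _) (Real.sqrt_nonneg _)
  calc b = A * Real.exp (-κ * m) * ((Λ₁.card : ℝ) * Λ₂.card) * ((K₁ : ℝ) * K₂) := by rw [hbdef]; ring
    _ ≤ A * (Real.exp κ * Real.exp (-κ * Dst)) * ((n : ℝ) * n) * ((K₁ : ℝ) * K₂) := by
        have hcc : (Λ₁.card : ℝ) * Λ₂.card ≤ (n : ℝ) * n :=
          mul_le_mul hn₁ hn₂ (Nat.cast_nonneg _) (Nat.cast_nonneg _)
        have hKK : (0 : ℝ) ≤ (K₁ : ℝ) * K₂ := mul_nonneg hK₁ hK₂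
        have hA' : 0 ≤ A * (Real.exp κ * Real.exp (-κ * Dst)) :=
          mul_nonneg hA (mul_nonneg (Real.exp_pos _).le (Real.exp_pos _).le)
        have hcc0 : (0 : ℝ) ≤ (Λ₁.card : ℝ) * Λ₂.card := mul_nonneg (Nat.cast_nonneg _) (Nat.cast_nonneg _)
        exact mul_le_mul_of_nonneg_right
          (mul_le_mul (mul_le_mul_of_nonneg_left hexp hA) hcc hcc0 hA') hKK
    _ = A * (n : ℝ) ^ 2 * Real.exp κ * Real.exp (-κ * Dst) * ((K₁ : ℝ) * K₂) := by ring
    _ ≤ A * (n : ℝ) ^ 2 * Real.exp κ * Real.exp (-κ * Dst) *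
          ((K₁ : ℝ) * K₂ + Real.sqrt (∫ U, F₁ U ^ 2 ∂μ) * Real.sqrt (∫ U, F₂ U ^ 2 ∂μ)) :=
        mul_le_mul_of_nonneg_left (le_add_of_nonneg_right hL2)
          (mul_nonneg (mul_nonneg (mul_nonneg hA (sq_nonneg _)) (Real.exp_pos _).le) (Real.exp_pos _).le)

end Transfer

end SharpClustering

end Summit.Ventures.YMGap
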